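import Mathlib
import Summits.ValiantsHypothesis.ValiantsHypothesis.Theorems.KPlusLogSqLawResolvedSmallBlocks
import Summits.ValiantsHypothesis.ValiantsHypothesis.Theorems.KPlusLogSqLawResolvedBlockDeficit

/-!
# KPlusLogSqLawResolvedFrustration — the frustration budget of the sign potential (all `N`)

Resolved (tropical, α-row) side of the K + log² programme; sequel to
`KPlusLogSqLawResolvedSmallBlocks` / `KPlusLogSqLawResolvedBlockDeficit`, cf. the route items
`Theses.KPlusLogSqLaw.DComb` / `ClosedWindowLaw` (stmt-ValiantsHypothesis-28100 / 28101).

The sign potential `Ψ(S) = ∑_{e ∈ S} sign (lam e)` has range `≤ N` over arbitrary edge sets.  Over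
MATCHINGS of the path (no two consecutive edges) the range shrinks by the FRUSTRATION: if `F` is a
set of indices `i` with `i + 1 < N` such that the edges `i, i+1` have the same sign and no two chosen
pairs are consecutive (`j ≠ i + 1` for `i, j ∈ F`), then for all matchings `S, S'`

`Ψ(S) - Ψ(S') ≤ N - |F|`            (`psi_range_le_sub_pairs`).

(The largest such `F` has `∑_runs ⌊ℓ/2⌋` elements, the sum over the maximal same-sign runs of the word.)
The proof is an injection `F⁺ → {positive edges} \ S`, `i ↦ (i ∈ S ? i+1 : i)` (and symmetrically for
the negative pairs and `S'`), packaged as `card_filter_add_card_le`.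

Consequently (`odd_steps_le_sub_pairs_add_deficit`), for a two-speed word and any chain of MATCHINGS
`μ₀, …, μ_L` with strictly increasing slopes,

`#{k : |μ_k ∆ μ_{k+1}| odd} ≤ (N - |F|) + ∑_k deficit |μ_k ∆ μ_{k+1}|`,

with the deficit formula `2 ⌊(ℓ-1)/6⌋ + 2·[ℓ ≡ 5 (mod 6)]` of the block-deficit file spelled out (no
definition is introduced).  In words: along a matching chain the total deficit of the steps of size `5`
or `≥ 7` can exceed the frustration `|F|` by at most the slack `N - #odd steps`; in particular the parity
count `#odd ≤ N` holds for every matching chain whose total deficit is at most `|F|`.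
-/

set_option linter.dupNamespace false

namespace Summit.ValiantsHypothesis.ValiantsHypothesis.Theorems.KPlusLogSqLaw.ResolvedFrustration

open Finset
open Summit.ValiantsHypothesis.ValiantsHypothesis.Theorems.KPlusLogSqLaw.ResolvedSmallBlocks
  (sum_sub_sum_eq_symmDiff psi_sub_psi_le)
open Summit.ValiantsHypothesis.ValiantsHypothesis.Theorems.KPlusLogSqLaw.ResolvedBlockDeficit
  (psi_step_deficit)

variable {N : ℕ}

/-- The injection lemma: if `F` is a set of non-consecutive indices `i` (`i + 1 < N`) with `p i` and
`p (i+1)`, and `S` has no two consecutive elements, then `#{e ∈ S | p e} + #F ≤ #{e | p e}`. -/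
theorem card_filter_add_card_le (p : Fin N → Prop) [DecidablePred p] (F S : Finset (Fin N))
    (hF : ∀ i ∈ F, (i : ℕ) + 1 < N)
    (hFp : ∀ i (hi : i ∈ F), p i ∧ p ⟨(i : ℕ) + 1, hF i hi⟩)
    (hFdisj : ∀ i ∈ F, ∀ j ∈ F, (j : ℕ) ≠ (i : ℕ) + 1)
    (hS : ∀ a ∈ S, ∀ b ∈ S, (b : ℕ) ≠ (a : ℕ) + 1) :
    (S.filter p).card + F.card ≤ (Finset.univ.filter p).card := by
  classical
  set P : Finset (Fin N) := Finset.univ.filter p with hP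
  have hmemP : ∀ e : Fin N, e ∈ P ↔ p e := by
    intro e; simp [hP]
  let φ : Fin N → Fin N := fun i =>
    if h : (i : ℕ) + 1 < N then (if i ∈ S then ⟨(i : ℕ) + 1, h⟩ else i) else i
  have hφ : ∀ i, φ i = if h : (i : ℕ) + 1 < N then (if i ∈ S then ⟨(i : ℕ) + 1, h⟩ else i) else i :=
    fun i => rfl
  have hmaps : Set.MapsTo φ ↑F ↑(P \ S) := by
    intro i hi
    have hi' : i ∈ F := hi
    have h1 := hF i hi'
    obtain ⟨hpi, hpi1⟩ := hFp i hi'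
    rw [Finset.mem_coe, hφ i, dif_pos h1]
    by_cases hiS : i ∈ S
    · rw [if_pos hiS, Finset.mem_sdiff]
      exact ⟨(hmemP _).mpr hpi1, fun hmem => hS i hiS _ hmem rfl⟩
    · rw [if_neg hiS, Finset.mem_sdiff]
      exact ⟨(hmemP _).mpr hpi, hiS⟩
  have hinj : Set.InjOn φ ↑F := by
    intro i hi j hj hij
    have hi' : i ∈ F := hi
    have hj' : j ∈ F := hj
    have hi1 := hF i hi'
    have hj1 := hF j hj'
    rw [hφ i, hφ j, dif_pos hi1, dif_pos hj1] at hij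
    by_cases hiS : i ∈ S <;> by_cases hjS : j ∈ S
    · rw [if_pos hiS, if_pos hjS] at hij
      have h := congrArg Fin.val hij
      exact Fin.ext (by simpa using h)
    · rw [if_pos hiS, if_neg hjS] at hij
      exact absurd (congrArg Fin.val hij).symm (hFdisj i hi' j hj')
    · rw [if_neg hiS, if_pos hjS] at hij
      exact absurd (congrArg Fin.val hij) (hFdisj j hj' i hi')
    · rw [if_neg hiS, if_neg hjS] at hij
      exact hij
  have hcard : F.card ≤ (P \ S).card := Finset.card_le_card_of_injOn φ hmaps hinj
  have hsplit : (P \ S).card + (P ∩ S).card = P.card := Finset.card_sdiff_add_card_inter P S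
  have hPS : P ∩ S = S.filter p := by
    ext e
    simp only [Finset.mem_inter, Finset.mem_filter, hmemP]
    exact And.comm
  rw [hPS] at hsplit
  omega

/-- `Ψ(S) ≤ #{e ∈ S | 0 < lam e}` for a two-speed word. -/
theorem psi_le_card_pos (lam : Fin N → ℤ) (hlam : ∀ e, lam e = 1 ∨ lam e = -1 ∨ lam e = 2 ∨ lam e = -2)
    (S : Finset (Fin N)) :
    ∑ e ∈ S, Int.sign (lam e) ≤ ((S.filter fun e => 0 < lam e).card : ℤ) := by
  rw [Finset.natCast_card_filter]
  have h2 : Int.sign 2 = 1 := by decide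
  refine Finset.sum_le_sum fun e _ => ?_
  rcases hlam e with h | h | h | h <;> simp [h, h2]

/-- `-Ψ(S) ≤ #{e ∈ S | lam e < 0}` for a two-speed word. -/
theorem neg_psi_le_card_neg (lam : Fin N → ℤ)
    (hlam : ∀ e, lam e = 1 ∨ lam e = -1 ∨ lam e = 2 ∨ lam e = -2) (S : Finset (Fin N)) :
    -∑ e ∈ S, Int.sign (lam e) ≤ ((S.filter fun e => lam e < 0).card : ℤ) := by
  rw [Finset.natCast_card_filter, ← Finset.sum_neg_distrib]
  have h2 : Int.sign 2 = 1 := by decide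
  refine Finset.sum_le_sum fun e _ => ?_
  rcases hlam e with h | h | h | h <;> simp [h, h2]

/-- **Frustration budget of the sign potential.** For a two-speed word, a set `F` of pairwise
non-consecutive same-sign adjacent pairs `(i, i+1)`, and two MATCHINGS `S, S'` (no two consecutive
edges), `Ψ(S) - Ψ(S') ≤ N - |F|`. -/
theorem psi_range_le_sub_pairs (lam : Fin N → ℤ)
    (hlam : ∀ e, lam e = 1 ∨ lam e = -1 ∨ lam e = 2 ∨ lam e = -2)
    (F : Finset (Fin N)) (hF : ∀ i ∈ F, (i : ℕ) + 1 < N)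
    (hFsign : ∀ i (hi : i ∈ F), (0 < lam i ∧ 0 < lam ⟨(i : ℕ) + 1, hF i hi⟩) ∨
      (lam i < 0 ∧ lam ⟨(i : ℕ) + 1, hF i hi⟩ < 0))
    (hFdisj : ∀ i ∈ F, ∀ j ∈ F, (j : ℕ) ≠ (i : ℕ) + 1)
    (S S' : Finset (Fin N))
    (hS : ∀ a ∈ S, ∀ b ∈ S, (b : ℕ) ≠ (a : ℕ) + 1)
    (hS' : ∀ a ∈ S', ∀ b ∈ S', (b : ℕ) ≠ (a : ℕ) + 1) :
    ∑ e ∈ S, Int.sign (lam e) - ∑ e ∈ S', Int.sign (lam e) ≤ N - F.card := by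
  classical
  -- split F by the sign of the pair
  set Fp := F.filter fun i => 0 < lam i with hFp
  set Fn := F.filter fun i => lam i < 0 with hFn
  have hFcard : Fp.card + Fn.card = F.card := by
    have h1 : Fn = F.filter fun i => ¬ 0 < lam i := by
      rw [hFn]
      refine Finset.filter_congr fun i hi => ?_
      rcases hlam i with h | h | h | h <;> simp [h]
    rw [h1, hFp]
    exact Finset.card_filter_add_card_filter_not _
  -- positive pairs vs S
  have hpos : (S.filter fun e => 0 < lam e).card + Fp.card ≤
      (Finset.univ.filter fun e : Fin N => 0 < lam e).card := by
    refine card_filter_add_card_le (fun e => 0 < lam e) Fp S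
      (fun i hi => hF i (Finset.mem_of_mem_filter i hi)) ?_ ?_ hS
    · intro i hi
      have hiF : i ∈ F := Finset.mem_of_mem_filter i hi
      have hip : 0 < lam i := (Finset.mem_filter.mp hi).2
      rcases hFsign i hiF with ⟨h0, h1⟩ | ⟨h0, h1⟩
      · exact ⟨hip, h1⟩
      · exact absurd hip (by omega)
    · intro i hi j hj
      exact hFdisj i (Finset.mem_of_mem_filter i hi) j (Finset.mem_of_mem_filter j hj)
  -- negative pairs vs S'
  have hneg : (S'.filter fun e => lam e < 0).card + Fn.card ≤
      (Finset.univ.filter fun e : Fin N => lam e < 0).card := by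
    refine card_filter_add_card_le (fun e => lam e < 0) Fn S'
      (fun i hi => hF i (Finset.mem_of_mem_filter i hi)) ?_ ?_ hS'
    · intro i hi
      have hiF : i ∈ F := Finset.mem_of_mem_filter i hi
      have hin : lam i < 0 := (Finset.mem_filter.mp hi).2
      rcases hFsign i hiF with ⟨h0, h1⟩ | ⟨h0, h1⟩
      · exact absurd hin (by omega)
      · exact ⟨hin, h1⟩
    · intro i hi j hj
      exact hFdisj i (Finset.mem_of_mem_filter i hi) j (Finset.mem_of_mem_filter j hj)
  -- positives and negatives partition the `N` edges
  have hPN : (Finset.univ.filter fun e : Fin N => 0 < lam e).card +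
      (Finset.univ.filter fun e : Fin N => lam e < 0).card ≤ N := by
    have hdisj : Disjoint (Finset.univ.filter fun e : Fin N => 0 < lam e)
        (Finset.univ.filter fun e : Fin N => lam e < 0) := by
      rw [Finset.disjoint_filter]
      intro e _ h
      omega
    rw [← Finset.card_union_of_disjoint hdisj]
    exact (Finset.card_le_univ _).trans (by simp)
  have h1 := psi_le_card_pos lam hlam S
  have h2 := neg_psi_le_card_neg lam hlam S'
  have h3 : ((S.filter fun e => 0 < lam e).card : ℤ) + Fp.card ≤
      ((Finset.univ.filter fun e : Fin N => 0 < lam e).card : ℤ) := by exact_mod_cast hpos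
  have h4 : ((S'.filter fun e => lam e < 0).card : ℤ) + Fn.card ≤
      ((Finset.univ.filter fun e : Fin N => lam e < 0).card : ℤ) := by exact_mod_cast hneg
  have h5 : ((Finset.univ.filter fun e : Fin N => 0 < lam e).card : ℤ) +
      ((Finset.univ.filter fun e : Fin N => lam e < 0).card : ℤ) ≤ N := by exact_mod_cast hPN
  have h6 : (Fp.card : ℤ) + Fn.card = F.card := by exact_mod_cast hFcard
  linarith

/-- **Parity law with frustration and deficits.** For a two-speed word, a set `F` of pairwise
non-consecutive same-sign adjacent pairs, and any chain of MATCHINGS with strictly increasing slopes,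
`#odd steps ≤ (N - |F|) + ∑_k deficit |μ_k ∆ μ_{k+1}|` (deficit formula spelled out). -/
theorem odd_steps_le_sub_pairs_add_deficit (N L : ℕ) (lam : Fin N → ℤ)
    (μ : Fin (L + 1) → Finset (Fin N))
    (hlam : ∀ e, lam e = 1 ∨ lam e = -1 ∨ lam e = 2 ∨ lam e = -2)
    (hmatch : ∀ k, ∀ e ∈ μ k, ∀ e' ∈ μ k, e'.val ≠ e.val + 1)
    (hslope : ∀ k : Fin L, ∑ e ∈ μ k.castSucc, lam e < ∑ e ∈ μ k.succ, lam e)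
    (F : Finset (Fin N)) (hF : ∀ i ∈ F, (i : ℕ) + 1 < N)
    (hFsign : ∀ i (hi : i ∈ F), (0 < lam i ∧ 0 < lam ⟨(i : ℕ) + 1, hF i hi⟩) ∨
      (lam i < 0 ∧ lam ⟨(i : ℕ) + 1, hF i hi⟩ < 0))
    (hFdisj : ∀ i ∈ F, ∀ j ∈ F, (j : ℕ) ≠ (i : ℕ) + 1) :
    ((Finset.univ.filter fun k : Fin L => Odd (symmDiff (μ k.castSucc) (μ k.succ)).card).card : ℤ) ≤
      (N - F.card) + ∑ k : Fin L, ((2 * (((symmDiff (μ k.castSucc) (μ k.succ)).card - 1) / 6) +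
          if (symmDiff (μ k.castSucc) (μ k.succ)).card % 6 = 5 then 2 else 0 : ℕ) : ℤ) := by
  have hcount : ((Finset.univ.filter fun k : Fin L =>
      Odd (symmDiff (μ k.castSucc) (μ k.succ)).card).card : ℤ) =
      ∑ k : Fin L, (if Odd (symmDiff (μ k.castSucc) (μ k.succ)).card then (1 : ℤ) else 0) := by
    rw [Finset.sum_ite, Finset.sum_const_zero, add_zero, Finset.sum_const, nsmul_eq_mul, mul_one]
  have hsteps : ∑ k : Fin L, (if Odd (symmDiff (μ k.castSucc) (μ k.succ)).card then (1 : ℤ) else 0) ≤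
      ∑ k : Fin L, ((∑ e ∈ μ k.succ, Int.sign (lam e) - ∑ e ∈ μ k.castSucc, Int.sign (lam e)) +
        ((2 * (((symmDiff (μ k.castSucc) (μ k.succ)).card - 1) / 6) +
          if (symmDiff (μ k.castSucc) (μ k.succ)).card % 6 = 5 then 2 else 0 : ℕ) : ℤ)) :=
    Finset.sum_le_sum fun k _ => psi_step_deficit lam hlam _ _ (hslope k)
  rw [Finset.sum_add_distrib] at hsteps
  let g : ℕ → ℤ := fun i =>
    if h : i ≤ L then ∑ e ∈ μ ⟨i, Nat.lt_succ_of_le h⟩, Int.sign (lam e) else 0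
  have htel : ∑ k : Fin L, (∑ e ∈ μ k.succ, Int.sign (lam e) - ∑ e ∈ μ k.castSucc, Int.sign (lam e)) =
      g L - g 0 := by
    have hfun : ∀ k : Fin L,
        ∑ e ∈ μ k.succ, Int.sign (lam e) - ∑ e ∈ μ k.castSucc, Int.sign (lam e) = g (k + 1) - g k := by
      intro k
      have hk1 : (k : ℕ) + 1 ≤ L := k.isLt
      have hk0 : (k : ℕ) ≤ L := k.isLt.le
      simp only [g, dif_pos hk1, dif_pos hk0]
      congr 2
    rw [Finset.sum_congr rfl fun k _ => hfun k]
    rw [Fin.sum_univ_eq_sum_range (fun i => g (i + 1) - g i) L, Finset.sum_range_sub]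
  have hrange : g L - g 0 ≤ N - F.card := by
    simp only [g, dif_pos (le_refl L), dif_pos (Nat.zero_le L)]
    exact psi_range_le_sub_pairs lam hlam F hF hFsign hFdisj _ _ (hmatch _) (hmatch _)
  rw [hcount]
  linarith

end Summit.ValiantsHypothesis.ValiantsHypothesis.Theorems.KPlusLogSqLaw.ResolvedFrustration
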